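import Mathlib.Probability.Distributions.Gaussian.Real
import Mathlib.Probability.Moments.Variance
import Mathlib.MeasureTheory.Function.L2Space
import HarnessLib

/-!
# Regev 2009, Claim 2.2: two centred Gaussians of close widths are statistically close

`Literature/Probability/Distributions/` (serves family `pqc`). Everything here is PROVED (theorems only,
no definition, no named fact).

**Claim 2.2** (Regev, J. ACM 56 (2009) = arXiv:2401.03703, §2): *"For any `0 < α < β ≤ 2α`,
`Δ(Ψ_α, Ψ_β) ≤ 9(β/α - 1)`."* Its printed proof bounds the statistical distance of the underlying
normal laws on `ℝ` (standard deviations `α/√(2π) < β/√(2π)`) and then reduces modulo `1` ("applying a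
function cannot increase the statistical distance"). We prove the real-line statement in event form for
Mathlib's `gaussianReal 0 σ²` (any `0 < σ₁ ≤ σ₂ ≤ 2σ₁`; the bound depends only on `t = σ₂/σ₁ = β/α`),
with the intermediate explicit bound `(t/2)(t² - 1) + (t - 1)` (which is `≤ 4(t - 1) ≤ 9(t - 1)`), and
restate it in the `α²/(2π)`-variance parametrisation of `LWENoise.lean` (`Ψ_α`, `Ψ̄_α`).

It is the tool of Regev's **Lemma 3.7** ("handling error `Ψ_β` for `β ≤ α`": pad the unknown `β` up to
some `α' ∈ [α, (1 + n^{-2c})α]`, at statistical cost `9n^{-2c}` per sample) inside Lemma 3.4 — the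
classical `BDD + DGS → LWE` step shared by Regev's quantum reduction (pqc.S19,
`Literature.Computability.Cryptography.regev_lwe_to_sivp_quantum` / `…_gapSVP_quantum`) and Peikert's
classical reduction (pqc.S20, hypothesis `h₂` of
`Literature.Computability.Cryptography.peikert_gapSVPZeta_to_lwe_classical_of_components`), whose
Lemma 3.11 core is `Cryptography/RegevBDDToLWESample.lean`.

## Results

* `integral_sq_gaussianReal_zero`, `integrable_sq_gaussianReal_zero` — `E[X²] = v` under `N(0, v)`
  (from Mathlib's `variance_fun_id_gaussianReal`).
* `gaussianPDFReal_zero_toNNReal_sq`, `gaussianPDFReal_eq_mul_exp` — `f₁ = f₂ · t · e^{-u}`,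
  `u(x) = (x²/2)(1/σ₁² - 1/σ₂²) ≥ 0`; `abs_gaussianPDFReal_sub_le` — the pointwise bound
  `|f₁ - f₂| ≤ f₂ · (t u + (t - 1))` from `1 - z ≤ e^{-z} ≤ 1`.
* `Regev2009.abs_gaussianReal_sub_gaussianReal_le` — for every measurable `A`,
  `|N(0,σ₁²)(A) - N(0,σ₂²)(A)| ≤ (t/2)(t² - 1) + (t - 1)` (`0 < σ₁ ≤ σ₂`, no upper constraint).
* `Regev2009.claim_2_2` — `≤ 9(σ₂/σ₁ - 1)` for `σ₂ ≤ 2σ₁` (as printed);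
  `Regev2009.claim_2_2_div_two_pi` — the same with variances `α²/(2π)`, `β²/(2π)`, `0 < α ≤ β ≤ 2α`.
* `Regev2009.exists_grid_pad`, `Regev2009.sqrt_sq_add_mul_sq_le`, `Regev2009.lemma_3_7_padding` — the
  padding step of **Lemma 3.7**: for unknown `0 < β ≤ α` and grid size `K` some `α' = √(β² + kα²/K)`,
  `k ≤ K`, has `α ≤ α' ≤ (1 + 1/K)α` and `|N(0,α²/(2π))(A) - N(0,α'²/(2π))(A)| ≤ 9/K`.

## Proof (as printed)

`|∫_A f₁ - ∫_A f₂| ≤ ∫ |f₁ - f₂| = ∫ |t e^{-u} - 1| f₂ ≤ ∫ (t(1 - e^{-u}) + (t - 1)) f₂ ≤ ∫ (t u + (t - 1)) f₂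
 = (t/2)(1/σ₁² - 1/σ₂²)·E_{N(0,σ₂²)}[X²] + (t - 1) = (t/2)(t² - 1) + (t - 1)`; Regev normalises `α = 1`,
`β = 1 + ε` and gets `ε + ε(1 + ε)³ ≤ 9ε`; without normalising, `(t - 1)((t/2)(t + 1) + 1) ≤ 4(t - 1)`.

## References

* O. Regev, *On lattices, learning with errors, random linear codes, and cryptography*, J. ACM 56
  (2009), art. 34 = arXiv:2401.03703, §2, Claim 2.2 and its proof; Lemma 3.7 (use) [RegevLWE2009]
  (held; `lit read arxiv:2401.03703`, chunks p0011–p0012, p0017).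
-/

noncomputable section

open MeasureTheory ProbabilityTheory Real
open scoped ENNReal NNReal

namespace Literature.Probability.Distributions

/-! ### Second moment of the centred Gaussian -/

/-- `E[X²] = v` for `X ∼ N(0, v)`. [folklore] -/
theorem integral_sq_gaussianReal_zero (v : ℝ≥0) : ∫ x, x ^ 2 ∂(gaussianReal 0 v) = v := by
  have h := variance_fun_id_gaussianReal (μ := (0 : ℝ)) (v := v)
  rw [variance_eq_integral measurable_id'.aemeasurable] at h
  simpa [integral_id_gaussianReal] using h

/-- `x ↦ x²` is integrable against `N(0, v)`. [folklore] -/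
theorem integrable_sq_gaussianReal_zero (v : ℝ≥0) : Integrable (fun x : ℝ => x ^ 2) (gaussianReal 0 v) :=
  (memLp_id_gaussianReal (μ := (0 : ℝ)) (v := v) 2).integrable_sq

/-! ### The density of `N(0, σ²)` and the pointwise comparison of two widths -/

/-- The Gaussian density in terms of the standard deviation: for `0 < σ`,
`gaussianPDFReal 0 σ² x = (σ√(2π))⁻¹ exp(-x²/(2σ²))`. [folklore] -/
theorem gaussianPDFReal_zero_toNNReal_sq {σ : ℝ} (hσ : 0 < σ) (x : ℝ) :
    gaussianPDFReal 0 (Real.toNNReal (σ ^ 2)) x = (σ * Real.sqrt (2 * π))⁻¹ * rexp (-x ^ 2 / (2 * σ ^ 2)) := by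
  rw [gaussianPDFReal, Real.coe_toNNReal _ (sq_nonneg σ), sub_zero]
  congr 2
  rw [show 2 * π * σ ^ 2 = (2 * π) * σ ^ 2 by ring, Real.sqrt_mul (by positivity), Real.sqrt_sq hσ.le,
    mul_comm]

/-- **Ratio of the two densities** (Regev 2009, proof of Claim 2.2): for `0 < σ₁ ≤ σ₂`,
`f₁(x) = f₂(x) · (σ₂/σ₁) · exp(-u(x))` with `u(x) = (x²/2)(1/σ₁² - 1/σ₂²) ≥ 0`. [cite: RegevLWE2009, Claim 2.2 (proof)] -/
theorem gaussianPDFReal_eq_mul_exp {σ₁ σ₂ : ℝ} (h1 : 0 < σ₁) (h12 : σ₁ ≤ σ₂) (x : ℝ) :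
    gaussianPDFReal 0 (Real.toNNReal (σ₁ ^ 2)) x =
      gaussianPDFReal 0 (Real.toNNReal (σ₂ ^ 2)) x *
        (σ₂ / σ₁ * rexp (-(x ^ 2 / 2 * (1 / σ₁ ^ 2 - 1 / σ₂ ^ 2)))) := by
  have h2 : 0 < σ₂ := h1.trans_le h12
  have hπ : 0 < Real.sqrt (2 * π) := Real.sqrt_pos.2 (by positivity)
  rw [gaussianPDFReal_zero_toNNReal_sq h1, gaussianPDFReal_zero_toNNReal_sq h2]
  rw [show (σ₂ * Real.sqrt (2 * π))⁻¹ * rexp (-x ^ 2 / (2 * σ₂ ^ 2)) *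
      (σ₂ / σ₁ * rexp (-(x ^ 2 / 2 * (1 / σ₁ ^ 2 - 1 / σ₂ ^ 2)))) =
      ((σ₂ * Real.sqrt (2 * π))⁻¹ * (σ₂ / σ₁)) *
        (rexp (-x ^ 2 / (2 * σ₂ ^ 2)) * rexp (-(x ^ 2 / 2 * (1 / σ₁ ^ 2 - 1 / σ₂ ^ 2)))) by ring,
    ← Real.exp_add]
  congr 1
  · field_simp
  · congr 1
    field_simp
    ring

/-- **Pointwise bound** (Regev 2009, proof of Claim 2.2: "since `1 - z ≤ e^{-z} ≤ 1` for all `z ≥ 0`"):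
for `0 < σ₁ ≤ σ₂` and `t = σ₂/σ₁`,
`|f₁(x) - f₂(x)| ≤ f₂(x) · (t · u(x) + (t - 1))`, `u(x) = (x²/2)(1/σ₁² - 1/σ₂²)`. [cite: RegevLWE2009, Claim 2.2 (proof)] -/
theorem abs_gaussianPDFReal_sub_le {σ₁ σ₂ : ℝ} (h1 : 0 < σ₁) (h12 : σ₁ ≤ σ₂) (x : ℝ) :
    |gaussianPDFReal 0 (Real.toNNReal (σ₁ ^ 2)) x - gaussianPDFReal 0 (Real.toNNReal (σ₂ ^ 2)) x| ≤
      gaussianPDFReal 0 (Real.toNNReal (σ₂ ^ 2)) x *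
        (σ₂ / σ₁ * (x ^ 2 / 2 * (1 / σ₁ ^ 2 - 1 / σ₂ ^ 2)) + (σ₂ / σ₁ - 1)) := by
  have h2 : 0 < σ₂ := h1.trans_le h12
  set g := gaussianPDFReal 0 (Real.toNNReal (σ₂ ^ 2)) x with hg
  set t := σ₂ / σ₁ with ht
  set u := x ^ 2 / 2 * (1 / σ₁ ^ 2 - 1 / σ₂ ^ 2) with hu
  have hg0 : 0 ≤ g := gaussianPDFReal_nonneg _ _ _
  have ht1 : 1 ≤ t := by rw [ht, one_le_div h1]; exact h12
  have hu0 : 0 ≤ u := by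
    rw [hu]
    refine mul_nonneg (by positivity) (sub_nonneg.2 ?_)
    exact one_div_le_one_div_of_le (by positivity) (pow_le_pow_left₀ h1.le h12 2)
  rw [gaussianPDFReal_eq_mul_exp h1 h12 x, ← hg, ← ht, ← hu,
    show g * (t * rexp (-u)) - g = g * (t * (rexp (-u) - 1) + (t - 1)) by ring, abs_mul,
    abs_of_nonneg hg0]
  refine mul_le_mul_of_nonneg_left ?_ hg0
  have he1 : rexp (-u) ≤ 1 := Real.exp_le_one_iff.2 (neg_nonpos.2 hu0)
  have he2 : 1 - u ≤ rexp (-u) := Real.one_sub_le_exp_neg u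
  calc |t * (rexp (-u) - 1) + (t - 1)| ≤ |t * (rexp (-u) - 1)| + |t - 1| := abs_add_le _ _
    _ = t * (1 - rexp (-u)) + (t - 1) := by
        rw [abs_mul, abs_of_nonneg (by linarith), abs_of_nonpos (by linarith),
          abs_of_nonneg (by linarith)]
        ring
    _ ≤ t * u + (t - 1) := by
        gcongr
        linarith

/-! ### Regev 2009, Claim 2.2 -/

/-- The bound of Claim 2.2 before the final estimate: with `t = σ₂/σ₁ ≥ 1`,
`∫ f₂ · (t·u + (t - 1)) = (t/2)(t² - 1) + (t - 1)` (`E[X²] = σ₂²` under `N(0, σ₂²)`). [cite: RegevLWE2009, Claim 2.2 (proof)] -/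
theorem integral_bound_eq {σ₁ σ₂ : ℝ} (h1 : 0 < σ₁) (h12 : σ₁ ≤ σ₂) :
    ∫ x, (σ₂ / σ₁ * (x ^ 2 / 2 * (1 / σ₁ ^ 2 - 1 / σ₂ ^ 2)) + (σ₂ / σ₁ - 1))
        ∂(gaussianReal 0 (Real.toNNReal (σ₂ ^ 2))) =
      σ₂ / σ₁ / 2 * ((σ₂ / σ₁) ^ 2 - 1) + (σ₂ / σ₁ - 1) := by
  have h2 : 0 < σ₂ := h1.trans_le h12
  have hint := integrable_sq_gaussianReal_zero (Real.toNNReal (σ₂ ^ 2))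
  have hfun : (fun x : ℝ => σ₂ / σ₁ * (x ^ 2 / 2 * (1 / σ₁ ^ 2 - 1 / σ₂ ^ 2)) + (σ₂ / σ₁ - 1)) =
      fun x : ℝ => (σ₂ / σ₁ / 2 * (1 / σ₁ ^ 2 - 1 / σ₂ ^ 2)) * x ^ 2 + (σ₂ / σ₁ - 1) := by
    funext x; ring
  rw [hfun, integral_add (hint.const_mul _) (integrable_const _), integral_const_mul,
    integral_sq_gaussianReal_zero, integral_const, Real.coe_toNNReal _ (sq_nonneg σ₂)]
  simp only [probReal_univ, smul_eq_mul, one_mul]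
  field_simp

/-- **Regev 2009, Claim 2.2 (event form on the real line, general widths).** For `0 < σ₁ ≤ σ₂` and
every measurable `A ⊆ ℝ`, with `t = σ₂/σ₁`:
`|N(0, σ₁²)(A) - N(0, σ₂²)(A)| ≤ (t/2)(t² - 1) + (t - 1)`.
Proof as printed: `|∫_A f₁ - ∫_A f₂| ≤ ∫ |f₁ - f₂| ≤ ∫ f₂·(t u + (t - 1))` (pointwise bound from
`1 - z ≤ e^{-z} ≤ 1`) `= (t/2)(t² - 1) + (t - 1)` (second moment of the wider Gaussian). [cite: RegevLWE2009, Claim 2.2] -/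
theorem Regev2009.abs_gaussianReal_sub_gaussianReal_le {σ₁ σ₂ : ℝ} (h1 : 0 < σ₁) (h12 : σ₁ ≤ σ₂)
    {A : Set ℝ} (hA : MeasurableSet A) :
    |(gaussianReal 0 (Real.toNNReal (σ₁ ^ 2))).real A - (gaussianReal 0 (Real.toNNReal (σ₂ ^ 2))).real A| ≤
      σ₂ / σ₁ / 2 * ((σ₂ / σ₁) ^ 2 - 1) + (σ₂ / σ₁ - 1) := by
  have h2 : 0 < σ₂ := h1.trans_le h12
  have hv1 : Real.toNNReal (σ₁ ^ 2) ≠ 0 := by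
    rw [ne_eq, Real.toNNReal_eq_zero, not_le]; positivity
  have hv2 : Real.toNNReal (σ₂ ^ 2) ≠ 0 := by
    rw [ne_eq, Real.toNNReal_eq_zero, not_le]; positivity
  set f₁ := gaussianPDFReal 0 (Real.toNNReal (σ₁ ^ 2)) with hf₁
  set f₂ := gaussianPDFReal 0 (Real.toNNReal (σ₂ ^ 2)) with hf₂
  set w : ℝ → ℝ := fun x => σ₂ / σ₁ * (x ^ 2 / 2 * (1 / σ₁ ^ 2 - 1 / σ₂ ^ 2)) + (σ₂ / σ₁ - 1) with hw
  -- the two probabilities as integrals of the densities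
  have hreal : ∀ {v : ℝ≥0} (hv : v ≠ 0), (gaussianReal 0 v).real A = ∫ x in A, gaussianPDFReal 0 v x := by
    intro v hv
    rw [measureReal_def, gaussianReal_apply_eq_integral 0 hv A,
      ENNReal.toReal_ofReal (setIntegral_nonneg hA fun x _ => gaussianPDFReal_nonneg _ _ _)]
  rw [hreal hv1, hreal hv2, ← integral_sub (integrable_gaussianPDFReal _ _).restrict
    (integrable_gaussianPDFReal _ _).restrict]
  -- integrability of the dominating function `f₂ · w` (it is `w` against `N(0, σ₂²)`)
  have hwint : Integrable w (gaussianReal 0 (Real.toNNReal (σ₂ ^ 2))) := by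
    have hint := integrable_sq_gaussianReal_zero (Real.toNNReal (σ₂ ^ 2))
    have hfun : w = fun x : ℝ => (σ₂ / σ₁ / 2 * (1 / σ₁ ^ 2 - 1 / σ₂ ^ 2)) * x ^ 2 + (σ₂ / σ₁ - 1) := by
      funext x; simp only [hw]; ring
    rw [hfun]
    exact (hint.const_mul _).add (integrable_const _)
  have hdom : Integrable (fun x => f₂ x * w x) := by
    have h := hwint
    rw [gaussianReal_of_var_ne_zero 0 hv2, integrable_withDensity_iff (measurable_gaussianPDF _ _)
      (Filter.Eventually.of_forall fun _ => gaussianPDF_lt_top)] at h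
    refine h.congr (Filter.Eventually.of_forall fun x => ?_)
    simp only [toReal_gaussianPDF, hf₂, mul_comm]
  -- the chain of inequalities
  calc |∫ x in A, (f₁ x - f₂ x)| ≤ ∫ x in A, |f₁ x - f₂ x| := abs_integral_le_integral_abs
    _ ≤ ∫ x, |f₁ x - f₂ x| :=
        setIntegral_le_integral (((integrable_gaussianPDFReal _ _).sub
          (integrable_gaussianPDFReal _ _)).abs) (Filter.Eventually.of_forall fun x => abs_nonneg _)
    _ ≤ ∫ x, f₂ x * w x :=
        integral_mono_of_nonneg (Filter.Eventually.of_forall fun x => abs_nonneg _) hdom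
          (Filter.Eventually.of_forall fun x => abs_gaussianPDFReal_sub_le h1 h12 x)
    _ = ∫ x, w x ∂(gaussianReal 0 (Real.toNNReal (σ₂ ^ 2))) := by
        rw [integral_gaussianReal_eq_integral_smul hv2]
        rfl
    _ = σ₂ / σ₁ / 2 * ((σ₂ / σ₁) ^ 2 - 1) + (σ₂ / σ₁ - 1) := integral_bound_eq h1 h12

/-- **Regev 2009, Claim 2.2, with Regev's constant.** *"For any `0 < α < β ≤ 2α`,
`Δ(Ψ_α, Ψ_β) ≤ 9(β/α - 1)`."* Proved here for the underlying normal laws on `ℝ` (standard deviations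
`σ₁ ≤ σ₂ ≤ 2σ₁`; Regev: `σ = α/√(2π)`, so `β/α = σ₂/σ₁`), on every measurable event — in fact with the
constant `4`: `(t/2)(t² - 1) + (t - 1) = (t - 1)((t/2)(t + 1) + 1) ≤ 4(t - 1)` for `t ≤ 2`. The torus /
discretised statements (`Ψ`, `Ψ̄`) follow since statistical distance cannot increase under a measurable
map (take `A` a preimage). [cite: RegevLWE2009, Claim 2.2] -/
theorem Regev2009.claim_2_2 {σ₁ σ₂ : ℝ} (h1 : 0 < σ₁) (h12 : σ₁ ≤ σ₂) (h2 : σ₂ ≤ 2 * σ₁)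
    {A : Set ℝ} (hA : MeasurableSet A) :
    |(gaussianReal 0 (Real.toNNReal (σ₁ ^ 2))).real A - (gaussianReal 0 (Real.toNNReal (σ₂ ^ 2))).real A| ≤
      9 * (σ₂ / σ₁ - 1) := by
  refine (Regev2009.abs_gaussianReal_sub_gaussianReal_le h1 h12 hA).trans ?_
  set t := σ₂ / σ₁ with ht
  have ht1 : 1 ≤ t := by rw [ht, one_le_div h1]; exact h12
  have ht2 : t ≤ 2 := by rw [ht, div_le_iff₀ h1]; exact h2
  nlinarith [mul_nonneg (sub_nonneg.2 ht1) (sub_nonneg.2 ht1)]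

/-- **Claim 2.2 in the `Ψ_α` parametrisation** (variances `α²/(2π) ≤ β²/(2π)`, as in
`LWE.wrappedGaussian` / `LWE.discretizedGaussian`): for `0 < α ≤ β ≤ 2α` and every measurable `A ⊆ ℝ`,
`|N(0, α²/(2π))(A) - N(0, β²/(2π))(A)| ≤ 9(β/α - 1)`. [cite: RegevLWE2009, Claim 2.2] -/
theorem Regev2009.claim_2_2_div_two_pi {α β : ℝ} (hα : 0 < α) (hαβ : α ≤ β) (hβ : β ≤ 2 * α)
    {A : Set ℝ} (hA : MeasurableSet A) :
    |(gaussianReal 0 (Real.toNNReal (α ^ 2 / (2 * π)))).real A -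
        (gaussianReal 0 (Real.toNNReal (β ^ 2 / (2 * π)))).real A| ≤ 9 * (β / α - 1) := by
  have hπ : 0 < Real.sqrt (2 * π) := Real.sqrt_pos.2 (by positivity)
  have hsq : ∀ γ : ℝ, γ ^ 2 / (2 * π) = (γ / Real.sqrt (2 * π)) ^ 2 := fun γ => by
    rw [div_pow, Real.sq_sqrt (by positivity)]
  rw [hsq α, hsq β]
  have h := Regev2009.claim_2_2 (σ₁ := α / Real.sqrt (2 * π)) (σ₂ := β / Real.sqrt (2 * π))
    (div_pos hα hπ) (div_le_div_of_nonneg_right hαβ hπ.le)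
    (by rw [mul_div_assoc']; exact div_le_div_of_nonneg_right hβ hπ.le) hA
  rwa [div_div_div_cancel_right₀ hπ.ne'] at h

/-! ### Regev 2009, Lemma 3.7: padding an unknown width `β ≤ α` up to the grid -/

/-- **The grid step of Lemma 3.7** (Regev 2009, proof of Lemma 3.7: "Let `Z` be the set of all integer
multiples of `n^{-2c}α²` between `0` and `α²` … Consider the smallest `γ ∈ Z` such that `γ ≥ α² - β²`.
Clearly, `γ ≤ α² - β² + n^{-2c}α²`"): for `u ≤ A` and a step `δ > 0` there is a multiple `kδ` with
`A ≤ u + kδ ≤ A + δ`. [cite: RegevLWE2009, Lemma 3.7 (proof)] -/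
theorem Regev2009.exists_grid_pad {u A δ : ℝ} (hu : u ≤ A) (hδ : 0 < δ) :
    ∃ k : ℕ, A ≤ u + k * δ ∧ u + k * δ ≤ A + δ := by
  refine ⟨⌈(A - u) / δ⌉₊, ?_, ?_⟩
  · have h := Nat.le_ceil ((A - u) / δ)
    rw [div_le_iff₀ hδ] at h
    linarith
  · have h := Nat.ceil_lt_add_one (div_nonneg (sub_nonneg.2 hu) hδ.le)
    have h' : (⌈(A - u) / δ⌉₊ : ℝ) * δ < ((A - u) / δ + 1) * δ := mul_lt_mul_of_pos_right h hδ
    rw [add_mul, div_mul_cancel₀ _ hδ.ne', one_mul] at h'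
    linarith

/-- `√(α² + εα²) ≤ (1 + ε)α` for `α, ε ≥ 0` (Regev: "`α' ≤ √(α² + n^{-2c}α²) ≤ (1 + n^{-2c})α`").
[cite: RegevLWE2009, Lemma 3.7 (proof)] -/
theorem Regev2009.sqrt_sq_add_mul_sq_le {α ε : ℝ} (hα : 0 ≤ α) (hε : 0 ≤ ε) :
    Real.sqrt (α ^ 2 + ε * α ^ 2) ≤ (1 + ε) * α := by
  rw [show (1 + ε) * α = Real.sqrt (((1 + ε) * α) ^ 2) by rw [Real.sqrt_sq (by positivity)]]
  exact Real.sqrt_le_sqrt (by nlinarith [sq_nonneg α, mul_nonneg hε (sq_nonneg α)])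

/-- **Regev 2009, Lemma 3.7, the padding step with its cost.** Let `0 < β ≤ α` (`β` unknown) and let
`K ≥ 1` be the grid size (`δ = α²/K`; Regev: `K = n^{2c}`). Some grid width
`α' = √(β² + k·α²/K)`, `k ≤ K`, satisfies `α ≤ α' ≤ (1 + 1/K)α`, and then (Claim 2.2) the padded noise
`N(0, α'²/(2π))` is within statistical distance `9/K` of the oracle's `N(0, α²/(2π))` on every
measurable event ("the statistical distance between `Ψ_α` and `Ψ_{α'}` is at most `9n^{-2c}`"); adding
independent `N(0, kα²/(2πK))` noise to `Ψ_β`-samples produces exactly `Ψ_{α'}`-samples (variances add),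
which is how the algorithm `W'` realises `α'` without knowing `β`. [cite: RegevLWE2009, Lemma 3.7 (proof) with Claim 2.2] -/
theorem Regev2009.lemma_3_7_padding {α β : ℝ} (hβ : 0 < β) (hβα : β ≤ α) {K : ℕ} (hK : 1 ≤ K) :
    ∃ k : ℕ, k ≤ K ∧ α ≤ Real.sqrt (β ^ 2 + k * (α ^ 2 / K)) ∧
      Real.sqrt (β ^ 2 + k * (α ^ 2 / K)) ≤ (1 + 1 / K) * α ∧
      ∀ A : Set ℝ, MeasurableSet A →
        |(gaussianReal 0 (Real.toNNReal (α ^ 2 / (2 * π)))).real A -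
          (gaussianReal 0 (Real.toNNReal (Real.sqrt (β ^ 2 + k * (α ^ 2 / K)) ^ 2 / (2 * π)))).real A| ≤
          9 / K := by
  have hα : 0 < α := hβ.trans_le hβα
  have hKpos : (0 : ℝ) < K := Nat.cast_pos.2 hK
  have hδ : 0 < α ^ 2 / K := by positivity
  obtain ⟨k, hk1, hk2⟩ := Regev2009.exists_grid_pad (pow_le_pow_left₀ hβ.le hβα 2) hδ
  set α' : ℝ := Real.sqrt (β ^ 2 + k * (α ^ 2 / K)) with hα'
  have hpos : 0 ≤ β ^ 2 + k * (α ^ 2 / K) := by positivity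
  -- `k ≤ K`: `kδ ≤ α² + δ - β² < (K + 1)δ`
  have hkK : k ≤ K := by
    have h1 : (k : ℝ) * (α ^ 2 / K) < (K + 1) * (α ^ 2 / K) := by
      have : (K + 1 : ℝ) * (α ^ 2 / K) = α ^ 2 + α ^ 2 / K := by field_simp
      rw [this]
      nlinarith [sq_nonneg β, hβ]
    have h2 : (k : ℝ) < K + 1 := lt_of_mul_lt_mul_right h1 hδ.le
    exact_mod_cast Nat.lt_add_one_iff.1 (by exact_mod_cast h2 : k < K + 1)
  -- `α ≤ α' ≤ (1 + 1/K) α`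
  have hlow : α ≤ α' := by
    calc α = Real.sqrt (α ^ 2) := (Real.sqrt_sq hα.le).symm
      _ ≤ α' := Real.sqrt_le_sqrt hk1
  have hup : α' ≤ (1 + 1 / K) * α := by
    refine le_trans (Real.sqrt_le_sqrt hk2) ?_
    rw [show α ^ 2 + α ^ 2 / K = α ^ 2 + (1 / K) * α ^ 2 by ring]
    exact Regev2009.sqrt_sq_add_mul_sq_le hα.le (by positivity)
  refine ⟨k, hkK, hlow, hup, fun A hA => ?_⟩
  have h2α : α' ≤ 2 * α := hup.trans (by
    have : (1 : ℝ) / K ≤ 1 := by rw [div_le_one hKpos]; exact_mod_cast hK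
    nlinarith)
  refine (Regev2009.claim_2_2_div_two_pi hα hlow h2α hA).trans ?_
  have h : α' / α - 1 ≤ 1 / K := by
    rw [div_sub_one hα.ne', div_le_iff₀ hα]
    linarith
  calc 9 * (α' / α - 1) ≤ 9 * (1 / K) := by gcongr
    _ = 9 / K := by ring

end Literature.Probability.Distributions
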